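import Mathlib
import Literature.MathematicalPhysics.QuantumFieldTheory.Balaban1983to89.T4OneStepFactorisation

/-!
# T⁴ programme, node NE3 (η-rate of the minimisers) — the TWO-SPACING RE-CUT of the (115)-currency wall

Fourth-generation leaf of the NE3 prover lineage P1 (technique: implicit-function / fixed-point structure of the
one-step constrained variational problem, Bałaban CMP 102 (1985) 277–309 = "B11", Sect. E).  Strictly ADDITIVE over
`T4OneStepFactorisation` (v1.3): nothing there is touched; the wall `LRRSized` (§4c there) is re-keyed, not moved.
Generation 5 (v1.1, §7: the CONSISTENCY × STABILITY re-cut — the discrete implicit-function theorem read as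
Lax–Keller "stability × consistency ⇒ convergence") is strictly additive over v1 (§1–§6 untouched except two verbatim
quote corrections in this docstring, owed to the v1 cross-read).

## What is printed and used ([R] = located reading, quoted «verbatim» from the materialised text; nothing else)

* [R] B9 = Bałaban, CMP 99 (1985) 389–434, p. 420, (3.122)–(3.123), (3.126): the hard-constrained quadratic
  minimisation is solved by a Lagrange multiplier — «We take the Lagrange function h(A,ω) = ½⟨A,G⁻¹A⟩ − ⟨ω, QA − B⟩,
  and we get the following equations for the minimum δh/δA = G⁻¹A − Q*ω = 0, δh/δω = QA − B = 0, hence A = GQ*ω,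
  QGQ*ω = B, ω = (QGQ*)⁻¹B, and finally A = GQ*(QGQ*)⁻¹B», «HB = GQ*(QGQ*)⁻¹B. (3.126)  We have obtained formally the
  same representation for the operator H as in [3,4] (1.103), (2.35)».  Used as the SHAPE of §1 (ring identities with
  these letters); no estimate of B9 is asserted.
* [R] B11 p. 284, (41)–(42): the variational problem is a minimum «on the space of field configurations A satisfying
  … Q(ηA) = B on …, |B| < 2dLC₁ε₁» — a HARD constraint; and p. 285 (45)–(46): the linear minimiser `H` («an
  operator defined on configurations B and giving a minimum of the quadratic form ½⟨A, ΔA⟩ under the restrictions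
  LʲηQ_jA = B on Λ_j, j = 0, 1,…, k, RD*A = 0») with «LʲηQ_jHB = B on Λ_j, RD*HB = 0, (45) and the Theorem 3.12 from [5] implies
  |HB| ≤ B₀(Lʲη)^{−1}|B|, |∇HB| ≤ B₀(Lʲη)^{−2}|B| on Ω_j. (46)» (printed TYPE of the projection constant `C_Π`).
* The consumers: `T4OneStepFactorisation.LRRSized` and `ne3Shape_of_lrrSized(_rpow)` (tree, accepted), i.e. the
  node's two-reading shape `T4EtaRateMin.NE3Shape` BY NAME.

## The observation of this generation (MODEL mathematics: exact linear algebra; the dictionary is stated, not asserted)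

Levels k (lattice T_η, "coarse", Laplacian Δ_c, Green operator G_c) and k+1 ("fine", Δ_f, G_f), one-step average
Q₁ (fine → coarse), k-fold average Q_k (coarse → unit lattice), TOWER Q_{k+1} = Q_k Q₁ (B7's composition rule, the
reading (Q) of record `t4/T4-EST-U1b-OSC.md` §2).  By B9 (3.123) at level k+1 the fine minimiser U_{k+1}(V) has its
CURRENT IN THE RANGE OF THE ADJOINT AVERAGING: Δ_f U_{k+1} = Q_{k+1}*ω̃ = Q₁*(Q_k*ω̃) (`hardMinimiser_current`,
`oneStep_multiplier_of_tower`), so the ONE-STEP multiplier of W := Q₁U_{k+1}(V) is λ = Q_k*ω̃ — blockwise the value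
of the fine current, hence PRINTED-SMALL (sup|λ̂| = sup|Ĵ_f| ≤ B·η³/L in level-k lattice units, B = the current
constant of B11 (2)/(8) read at level k+1; one power of L to spare).  The Schur complement S := Q₁G_fQ₁* inverts the
one-step effective operator Λ (S Λ = 1 − P₀), and the ring identity of this file (`correction_eq_lap_mul_twoSpacing`)
    Λ − Δ_c = Δ_c · E · Λ,   E := G_c − S = G_c − Q₁ G_f Q₁*  (the TWO-SPACING PROPAGATOR DIFFERENCE)
says that the one-step correction current J^δ(W) = (Λ − Δ_c)W has the Laplacian-range representation of §4b of
`T4OneStepFactorisation` with the EXPLICIT pre-current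
    Z = E · λ,   λ = ΛW = Q_k*ω̃,   and   X := U_k(V) − Q₁U_{k+1}(V) = 𝔊_k J^δ(W) = (1 − Π_k) · E · λ
(`propagated_correction_eq_twoSpacing`; equivalently `twoLevel_response_repr`: X = −(1 − Π_k)W and the coset
W + ker(1 − Π_k) ∋ −Eλ, because a field whose current is blockwise constant on unit cubes is its own hard minimiser).
CONSEQUENCE FOR THE WALL: clause 1 of `LRRSized` (sup|Ẑ| ≤ C_Z·B·(1 + k log L)·η³, the one unprinted clause) follows
from  sup|Z| ≤ ‖E‖_{ℓ∞→ℓ∞} · sup|λ|  (`abs_sum_mul_le`) and a POINTWISE KERNEL BOUND on E (shell summation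
`shell_sum_le` + the harmonic bound, `rowConst_le`): |E(x,y)| ≤ e₀·[near] + C·|x − y|^{−d} on the η-torus of side
N = ℓL^k gives ‖E‖_{ℓ∞→ℓ∞} ≤ e₀′ + A·C·(1 + log ℓ + k log L) ≤ C_E·(1 + k log L)  (`lrrSized_of_twoSpacing`,
`ne3Shape_of_twoSpacing(_rpow)`: the node's shape BY NAME from the re-keyed wall `TwoSpacingSized`).

## What is NOT printed (the re-keyed wall, honest) and what the toy says

THE WALL, RE-TYPED (`TwoSpacingSized` clause 2, resp. the pointwise bound behind it): for Bałaban's covariant,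
gauge-fixed, LINEARISED one-step objects on a class-(14) background — E_W := 𝒢_c(W) − Q_W 𝒢_f(u) Q_W* with the
zero-mode-projected (NOT the averaging-massive) propagators — the kernel bound |E_W(x,y)| ≤ e₀𝟙 + C(1 + |x − y|)^{−d}
uniformly on the class.  NOT PRINTED in B4–B13 (B9 §3 bounds single massive propagators at one level; nothing
two-spacing).  Printed relatives, flat scalar: the sharp Green-function asymptotics G(x) = a_d|x|^{2−d} + o(|x|^{−α}),
α < d (Lawler 1991, Thm 1.5.4; O(|x|^{−d}) with the cubic-harmonic term: Uchiyama 1998 / Lawler–Limic Thm 4.3.1), and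
the blocked-Gaussian one-step formula Λ(P)⁻¹ = Σ_l |q̂(p_l)|²/K(p_l) (Bell–Wilson 1975; Bietenholz, CUP, §5.3 (5.18)).
[toy; `t4/b2b-balaban-t4-ne3-p1/g4/two_spacing_toy.py`, pure python, exact symbols + FFT, < 1 core-minute]
flat scalar block means, L = 2: (i) d = 1: E = κ_L(δ − 1/N) EXACTLY (= tree `blockAvg_green`; §5 here: row sum
2κ_L(1 − 1/N) < 1/3, no logarithm); (ii) d = 2, 3, 4 (N up to 512, 128, 32): sup_{y≠0}|E(y)|·|y|^d = 0.0230 /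
0.0230 / 0.0325, STABLE in N — the pointwise two-spacing bound holds with a CZ tail (angular profile ∝ cos 4θ in
d = 2: axis +0.0086, diagonal −0.0127); (iii) row sums Σ_y|E(y)| grow LINEARLY in log N: +0.02756 per doubling of N
(d = 2, N = 256 → 512; predicted (κ_L/π)·ln 2 = 0.02758 from the Bochner–Hecke constant of the cubic harmonic h₄),
+0.04756 (d = 3, 64 → 128; predicted 0.04757), +0.06536 (d = 4, 16 → 32; predicted 0.06534) — so ‖E‖_{ℓ∞→ℓ∞}
genuinely carries (1 + k log L), exactly as clause 1 tolerates; (iv) BUT on the exact data class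
Range(Q_k*) the logarithm CANCELS: Σ_blocks|Σ_{y∈block}E(x,y)| at block side N/4 is 0.213 / 0.223 / 0.200 (corner /
face / centre source, d = 2) and 0.233–0.240 (d = 3), FLAT as N doubles (increments ÷2 per doubling), while the plain
row sum climbs 0.28 → 0.39.  [analysis] mechanism: reflection symmetry of the even symbol (record v1.1 RESULT 5 (α))
near the source, a unit-lattice sum far from it; for B7's covariant averaging of 1-forms, Range(Q_{k,W}*) is
tree-supported and multiscale and the cancellation is OPEN — clause 1 is typed log-tolerant for that reason.

## Generation 5 (§7): CONSISTENCY × STABILITY — the two-level response is the propagated two-grid truncation error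

* [R] B5 = Bałaban, CMP 95 (1984) 17–40, p. 19, (1.11): the averaging actually used for gauge fields is the STRAIGHT
  SLAB average «(QA)_c = Σ_{x∈B(c₋)} L^{−(d+1)}A([x, x(c)]), δ(B − QA) = Π_{c⊂T_L^{(1)}} δ(B_c − (QA)_c)» («if
  c = ⟨y, y + Le_μ⟩ then x(c) = x + Le_μ»; «We may define the averaging operation as given by Q directly. … In the
  future we will use both points of view.», the other being (1.8) with the contours Γ).  Consequence used only as
  SHAPE: `C₁ := Q₁Q₁*` is NOT the identity for slab means (it is for block means); `1 − C₁` is a second difference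
  along the averaged direction, killing constants.
* [model] The identities of §7 (exact algebra; [toy]-verified to 1e-9 in d = 1, 2, 3 for block AND slab means): with the
  LOCAL TWO-GRID CONSISTENCY DEFECT `K := Q₁Δ_f − Δ_cQ₁` (fine Laplacian in coarse units),
  `Q₁G_f = G_cQ₁ − G_cKG_f` (`avg_green_comm(_inv)`), `E = G_cKG_fQ₁* + G_c(1 − C₁)` (`twoSpacing_eq_consistency`),
  and for the two-level response `X = U_k − Q₁U_{k+1} = (1 − Π_k)·G_c·[τ − (C₁ − 1)λ]`, `τ := K·U_{k+1}` the two-grid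
  TRUNCATION ERROR of the fine minimiser, `λ = Q_k*ω̃` (`twoLevel_response_eq_consistency`); the averaging mass of B9
  (3.122) («G⁻¹ = Δ_π + DRD* + Q*aQ») does not change the minimiser (`green_avgMass_pushThrough`,
  `hardMinimiser_indep_of_avgMass`), so the massless bookkeeping is legitimate for the printed massive propagators;
  `K` has zero total charge (`truncation_neutral`) and annihilates affine functions, so `τ` is a NEUTRAL (dipole) layer
  on the unit-face skeleton and `G_cτ` a double-layer potential — bounded by the multiplier size, the absolute layer sum
  costing at most the `(1 + k log L)` that clause 1 tolerates (`layer_sum_le` = `shell_sum_le` one dimension down).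
* THE WALL, RE-CUT (`ConsistencySized`, clauses (T2)–(T4); BOTH inputs single-level, NEITHER printed): (W1) STABILITY —
  a POINTWISE sub-unit profile of B9's propagator kernels, `|∇_yG_k(x,y)| ≤ C|x − y|^{1−d}` for `1 ≤ |x − y| ≤ L^k`
  (B9 prints unit-cube-localised OPERATOR bounds (3.42)–(3.47) and bounded kernels (3.49), (3.133); in sup norm these do
  not see the thinness of a layer); (W2) CONSISTENCY — the transmission structure of `U_{k+1}(V)` across unit faces
  (face dipole density `≤ C_J·sup|λ̂|`, the rest `≤ C_B(1 + k log L)·sup|λ̂|`; B11 (9)–(10) print global `C^{1,β}` and a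
  bounded covariant Laplacian only).  `ConsistencySized ⇒ LRRSized ⇒ NE3Shape` BY NAME with `C_Z = C_DL·C_J + C_B`
  (`lrrSized_of_consistency`, `ne3Shape_of_consistency(_rpow)`).
* [toy; `t4/b2b-balaban-t4-ne3-p1/g5/consistency_toy.py`, pure python, exact symbols + FFT, < 3 core-minutes; flat
  scalar, L = ℓ = 2, data δ − mean] (v) `τ` is face-localised: ≥ 96.4 % of `Σ|τ|` within sup-distance 1 of the unit-face
  planes, ≤ 2.1 % at distance ≥ 3 (all d, k, both averagings); per face: net charge/(jump·area) → 0 (−1·10⁻⁴ at d = 2,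
  k = 8), dipole/(jump·area) → κ_L = (L² − 1)/(6L²) = 0.125 (0.1250 d = 1 exactly = `blockAvg_green`; 0.1244 d = 2,
  k = 8; 0.105 d = 3, k = 4, rising); (vi) `sup|G_c[τ − (C₁−1)λ]| / sup|λ̂|` is FLAT in k: → κ_L = 0.125 (block, d = 1, 2;
  0.1248 at k = 8), 0.149 (slab, d = 2), 0.116 / 0.132 (d = 3, k = 4); (vii) after projection, d = 2 block, k = 4…8:
  `sup|X|/sup|λ̂|` = .097 .103 .111 .116 .119 and the (115)-GRADIENT entry `sup|∇̂X|/sup|λ̂|` = .151 .172 .182 .188 .190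
  — increments halving, NO logarithm in either entry (slab: .099 / .182 at k = 8; d = 3, k = 4: .134 / .129): in the
  flat model the re-cut wall holds with room and the typed `(1 + k log L)` is not even attained.

Honest framing: finite T⁴ ultraviolet statement only; nothing here bears on infinite volume or a mass gap.  No `sorry`,
no new axioms; ring identities are [folklore]; every [model]/[toy]/[analysis] sentence is dictionary or evidence, never
a hypothesis discharged by citation.  Records: `t4/T4-EST-U1b-OSC.md` v1.4 §4″ (v1.6 §4‴ for generation 5), GAPS
G-ne3p1-13, G-ne3p1-14, C-ne3p1-15 (generation 5: G-ne3p1-16 ff.).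
-/

namespace Literature.MathematicalPhysics.QuantumFieldTheory.Balaban1983to89.T4TwoSpacingDefect

open Finset
open Literature.MathematicalPhysics.QuantumFieldTheory.Balaban1983to89.T4OneStepKernel1D (kappa kappa_lt_one_sixth)
open Literature.MathematicalPhysics.QuantumFieldTheory.Balaban1983to89.T4FixedPointResponse (OneStepCorrectionRate)
open Literature.MathematicalPhysics.QuantumFieldTheory.Balaban1983to89.T4EtaRateMin (Readings LocalRate NE3Shape)
open Literature.MathematicalPhysics.QuantumFieldTheory.Balaban1983to89.T4OneStepFactorisation

/-! ## §1 Ring identities: the multiplier, the tower, and `Λ − Δ = Δ·E·Λ` -/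

section RingIdentities

variable {R : Type*} [Ring R]

/-- **B9 (3.122)–(3.126), as algebra.**  If `u = Q G Q*` is a unit then `H := G Q* u⁻¹` satisfies the constraint
`Q H = 1` («LʲηQ_jHB = B», B11 (45)).  [model] Dictionary: `G` = a propagator of the fine problem, `Q` the averaging,
`Qad = Q*`; `H` = «HB = GQ*(QGQ*)⁻¹B» (B9 (3.126)). [cite: Balaban1985BackgroundPropagators, (3.126) p.420] -/
theorem hardMinimiser_constraint {G Q Qad : R} (u : Rˣ) (hu : (u : R) = Q * G * Qad) :
    Q * (G * Qad * ↑u⁻¹) = 1 := by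
  have h1 : Q * (G * Qad * ↑u⁻¹) = (Q * G * Qad) * ↑u⁻¹ := by noncomm_ring
  rw [h1, ← hu, Units.mul_inv]

/-- **The current of a hard minimiser lies in the range of the adjoint averaging** (B9 p. 420: «G⁻¹A − Q*ω = 0 …
ω = (QGQ*)⁻¹B»): with `Gi G = 1`, `Gi (G Q* u⁻¹) = Q* u⁻¹`, i.e. `G⁻¹ H = Q* (QGQ*)⁻¹`.  [model] In the flat
linearised dictionary `Gi = Δ_f` (+ the averaging term, which only shifts `ω` by `aB`), so the fine CURRENT
`Δ_f U_{k+1}(V)` equals `Q_{k+1}* ω̃` — blockwise constant on unit cubes. [cite: Balaban1985BackgroundPropagators, (3.123) p.420] -/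
theorem hardMinimiser_current {Gi G Qad : R} (u : Rˣ) (hGiG : Gi * G = 1) :
    Gi * (G * Qad * ↑u⁻¹) = Qad * ↑u⁻¹ := by
  rw [← mul_assoc, ← mul_assoc, hGiG, one_mul]

/-- **Tower ⇒ the one-step multiplier.**  If the (k+1)-fold adjoint factorises `Q_{k+1}* = Q₁* Q_k*` (B7's composition
rule Q_{k+1} = Q_k Q₁, reading (Q)) and the fine current is `Gi A = Q_{k+1}* ω`, then `Gi A = Q₁* (Q_k* ω)`: the
ONE-STEP multiplier of `W = Q₁A` is `λ = Q_k* ω` — the k-fold adjoint lift of a unit-lattice field. [folklore] -/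
theorem oneStep_multiplier_of_tower {Gi A Q1ad Qkad Qk1ad ω : R} (hcur : Gi * A = Qk1ad * ω)
    (htower : Qk1ad = Q1ad * Qkad) : Gi * A = Q1ad * (Qkad * ω) := by
  rw [hcur, htower, mul_assoc]

/-- **THE TWO-SPACING IDENTITY.**  In a ring: if `Δ G = 1 − P` (Green operator of the coarse Laplacian modulo the
zero mode), `S Λ = 1 − P` (the one-step effective operator `Λ` inverts the Schur complement `S = Q₁G_fQ₁*` modulo
the zero mode), `Δ P = 0` and `P Λ = 0`, then the one-step correction operator factorises through the Laplacian ON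
THE LEFT with the explicit second factor `E Λ`, `E := G − S` the TWO-SPACING PROPAGATOR DIFFERENCE:
`Λ − Δ = Δ · ((G − S) · Λ)`.  This is the hypothesis `hM : M = Δ * N` of
`T4OneStepFactorisation.propagated_correction_eq` with `N = E Λ`.  [model] 1D check: `S = G − κ(1 − P)`,
`Λ = Δ(1 − κΔ)⁻¹` give `E Λ = κ(1 − P)Δ(1 − κΔ)⁻¹ = n Δ` (`correction_eq_lap_mul`). [folklore] -/
theorem correction_eq_lap_mul_twoSpacing {Δ G P S Λ : R} (hΔG : Δ * G = 1 - P) (hSΛ : S * Λ = 1 - P)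
    (hΔP : Δ * P = 0) (hPΛ : P * Λ = 0) : Λ - Δ = Δ * ((G - S) * Λ) := by
  have h1 : Δ * ((G - S) * Λ) = (Δ * G) * Λ - Δ * (S * Λ) := by noncomm_ring
  rw [h1, hΔG, hSΛ, sub_mul, one_mul, hPΛ, sub_zero, mul_sub, mul_one, hΔP, sub_zero]

/-- **Propagated form: `𝔊 J^δ = (1 − Π) E Λ`.**  With the constrained Green identity `𝔊 Δ = 1 − Π`
(`T4OneStepFactorisation.constrainedGreen_mul_laplacian`) the propagated one-step correction is
`𝔊 (Λ − Δ) = (1 − Π) · (G − S) · Λ`: NO propagator acts on the correction; what remains is the two-spacing difference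
applied to the (printed-small) multiplier.  [model] Applied to `W = Q₁U_{k+1}(V)`: `X = (1 − Π_k) E λ`, `λ = ΛW`. [folklore] -/
theorem propagated_correction_eq_twoSpacing {𝔊 Δ Pm G P S Λ : R} (h𝔊Δ : 𝔊 * Δ = 1 - Pm)
    (hΔG : Δ * G = 1 - P) (hSΛ : S * Λ = 1 - P) (hΔP : Δ * P = 0) (hPΛ : P * Λ = 0) :
    𝔊 * (Λ - Δ) = (1 - Pm) * ((G - S) * Λ) :=
  propagated_correction_eq h𝔊Δ (correction_eq_lap_mul_twoSpacing hΔG hSΛ hΔP hPΛ)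

/-- **Honestly invertible form (the averaging-massive propagators of B9).**  For units `G`, `S` of a ring,
`S⁻¹ − G⁻¹ = G⁻¹ (G − S) S⁻¹`.  [model] Dictionary: `G = G_{k,a} = (Δ_c + aQ_k*Q_k)⁻¹` and `S = Q₁G_{k+1,a}Q₁*`
(B9's propagators WITH the averaging term, consecutive levels, the finer one block-averaged once); then
`S⁻¹ − G⁻¹ = (Λ + aQ_k*Q_k) − (Δ_c + aQ_k*Q_k) = Λ − Δ_c` is the SAME correction operator, so `E` may be read massive
or massless — but only the massless reading pairs with the printed-small multiplier (module docstring). [folklore] -/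
theorem inv_sub_inv_eq_twoSpacing (G S : Rˣ) :
    (↑S⁻¹ : R) - ↑G⁻¹ = ↑G⁻¹ * ((G : R) - S) * ↑S⁻¹ := by
  rw [mul_sub, Units.inv_mul, sub_mul, one_mul, mul_assoc, Units.mul_inv, mul_one]

/-- **The two-level response, represented.**  If `Π` fixes every field generated by a unit-block-constant current
(`(1 − Π)(G_c Q_k*) = 0`: such a field is its own hard minimiser — the Lagrange condition of B9 (3.123) read
backwards), then `−(1 − Π)(S Q_k* ω) = (1 − Π)((G_c − S) Q_k* ω)`.  [model] Dictionary: `W = Q₁U_{k+1}(V) = S Q_k*ω̃`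
(+ constants, killed by `1 − Π`), `X = U_k(V) − W = −(1 − Π_k)W` (`twoLevel_response_eq`), hence
`X = (1 − Π_k) · E · Q_k*ω̃`: the response is `1 − Π_k` applied to the difference between the level-k potential of the
block-lifted fine current and the block average of the fine potential — the same source at two spacings. [folklore] -/
theorem twoLevel_response_repr {Pi Gc S Qkad ω : R} (hfix : (1 - Pi) * (Gc * Qkad) = 0) :
    -((1 - Pi) * (S * (Qkad * ω))) = (1 - Pi) * ((Gc - S) * (Qkad * ω)) := by
  have h1 : (1 - Pi) * ((Gc - S) * (Qkad * ω))
      = (1 - Pi) * (Gc * Qkad) * ω - (1 - Pi) * (S * (Qkad * ω)) := by noncomm_ring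
  rw [h1, hfix, zero_mul, zero_sub]

/-- `X = U − W = −(1 − Π)W` as soon as `Π W = U` (the coarse hard minimiser is the minimiser∘average image of `W`,
both having the averages `V`). [folklore] -/
theorem twoLevel_response_eq {Pi U W : R} (hPi : Pi * W = U) : U - W = -((1 - Pi) * W) := by
  rw [sub_mul, one_mul, hPi, neg_sub]

end RingIdentities

/-! ## §2 From a kernel row to the sup bound (finite sums) -/

section RowSum

/-- **sup|E λ| ≤ (row sum of |E|) · sup|λ|**, one row: `|Σ_y E_y λ_y| ≤ (Σ_y |E_y|) · M` if `|λ_y| ≤ M`.  [model]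
Dictionary: `E_y = E(x,y)` a row of the two-spacing kernel, `λ` the one-step multiplier, `M = B·η³/L`. [folklore] -/
theorem abs_sum_mul_le {ι : Type*} (s : Finset ι) (E lam : ι → ℝ) {M : ℝ} (hM : ∀ y ∈ s, |lam y| ≤ M) :
    |∑ y ∈ s, E y * lam y| ≤ (∑ y ∈ s, |E y|) * M := by
  calc |∑ y ∈ s, E y * lam y| ≤ ∑ y ∈ s, |E y * lam y| := abs_sum_le_sum_abs _ _
    _ = ∑ y ∈ s, |E y| * |lam y| := by simp_rw [abs_mul]
    _ ≤ ∑ y ∈ s, |E y| * M := sum_le_sum fun y hy => mul_le_mul_of_nonneg_left (hM y hy) (abs_nonneg _)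
    _ = (∑ y ∈ s, |E y|) * M := by rw [sum_mul]

end RowSum

/-! ## §3 The shell summation: a `|x − y|^{−d}` kernel on a torus of side `N` has row sums `O(1 + log N)` -/

section Shell

/-- **Shell summation.**  Abstract form of the lattice estimate `Σ_{y} |E(x,y)| ≤ e₀ + A·C·(1 + log N)`: index the
sites `y ∈ s` by an integer "radius" `ρ y ≤ N` (sup-distance to `x` on the torus); if the shells have
`#{ρ = r} ≤ A·r^{d−1}` sites (`r ≥ 1`; on `ℤ^d`, `#{‖y‖_∞ = r} = (2r+1)^d − (2r−1)^d ≤ 2d·3^{d−1}·r^{d−1}`), the core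
`{ρ = 0}` carries at most `e₀`, and `|f y| ≤ C·(ρ y)^{−d}` off the core, then `Σ_{y∈s} |f y| ≤ e₀ + A·C·(1 + log N)`.
[model] Dictionary: `f = E(x,·)` the two-spacing kernel row, `N = ℓ·L^k` the side of `T_η` in lattice units. [folklore] -/
theorem shell_sum_le {ι : Type*} (s : Finset ι) (ρ : ι → ℕ) (f : ι → ℝ) {N d : ℕ} (hd : 1 ≤ d) {A e₀ C : ℝ}
    (hA : 0 ≤ A) (hC : 0 ≤ C) (hρN : ∀ y ∈ s, ρ y ≤ N)
    (hcard : ∀ r : ℕ, 1 ≤ r → (((s.filter fun y => ρ y = r).card : ℝ)) ≤ A * (r : ℝ) ^ (d - 1))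
    (h0 : ∑ y ∈ s.filter (fun y => ρ y = 0), |f y| ≤ e₀)
    (hf : ∀ y ∈ s, 1 ≤ ρ y → |f y| ≤ C / (ρ y : ℝ) ^ d) :
    ∑ y ∈ s, |f y| ≤ e₀ + A * C * (1 + Real.log N) := by
  -- fibre the sum over the radius r ∈ range (N+1)
  have hmaps : ∀ y ∈ s, ρ y ∈ range (N + 1) := fun y hy => mem_range.mpr (Nat.lt_succ_of_le (hρN y hy))
  rw [← sum_fiberwise_of_maps_to hmaps]
  -- split off r = 0
  rw [Finset.range_eq_Ico, Finset.sum_eq_sum_Ico_succ_bot (Nat.succ_pos N)]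
  -- each shell r ≥ 1 contributes at most A C / r
  have hshell : ∀ r ∈ Ico 1 (N + 1), ∑ y ∈ s.filter (fun y => ρ y = r), |f y| ≤ A * C * ((r : ℝ))⁻¹ := by
    intro r hr
    have hr1 : 1 ≤ r := (mem_Ico.mp hr).1
    have hr0 : (0 : ℝ) < r := by exact_mod_cast hr1
    calc ∑ y ∈ s.filter (fun y => ρ y = r), |f y|
        ≤ ∑ y ∈ s.filter (fun y => ρ y = r), C / (r : ℝ) ^ d := by
          refine sum_le_sum fun y hy => ?_
          obtain ⟨hys, hyr⟩ := mem_filter.mp hy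
          have := hf y hys (hyr ▸ hr1)
          rwa [hyr] at this
      _ = ((s.filter fun y => ρ y = r).card : ℝ) * (C / (r : ℝ) ^ d) := by rw [sum_const, nsmul_eq_mul]
      _ ≤ A * (r : ℝ) ^ (d - 1) * (C / (r : ℝ) ^ d) :=
          mul_le_mul_of_nonneg_right (hcard r hr1) (by positivity)
      _ = A * C * ((r : ℝ))⁻¹ := by
          have hsplit : (r : ℝ) ^ d = (r : ℝ) ^ (d - 1) * r := by
            rw [← pow_succ, Nat.sub_add_cancel hd]
          rw [hsplit]
          field_simp
  have hIcc : Ico 1 (N + 1) = Icc 1 N := by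
    ext r; simp only [mem_Ico, mem_Icc]; omega
  calc ∑ y ∈ s.filter (fun y => ρ y = 0), |f y| + ∑ r ∈ Ico 1 (N + 1), ∑ y ∈ s.filter (fun y => ρ y = r), |f y|
      ≤ e₀ + ∑ r ∈ Ico 1 (N + 1), A * C * ((r : ℝ))⁻¹ := add_le_add h0 (sum_le_sum hshell)
    _ = e₀ + A * C * ∑ r ∈ Icc 1 N, ((r : ℝ))⁻¹ := by rw [← mul_sum, hIcc]
    _ ≤ e₀ + A * C * (1 + Real.log N) := by
        -- the harmonic bound `Σ_{r=1}^{N} 1/r ≤ 1 + log N` (Mathlib's `harmonic_le_one_add_log`; the same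
        -- rewriting as the tree's `Literature.NumberTheory.Sieve.harmonic_Icc_le`, not imported here)
        have hharm : ∑ r ∈ Icc 1 N, ((r : ℝ))⁻¹ ≤ 1 + Real.log N := by
          have h := harmonic_le_one_add_log N
          simp_rw [harmonic_eq_sum_Icc, Rat.cast_sum, Rat.cast_inv, Rat.cast_natCast] at h
          exact h
        have := mul_le_mul_of_nonneg_left hharm (mul_nonneg hA hC)
        linarith

/-- **The row constant in the shape of clause 1.**  With the torus side `N = ℓ·L^k` (`ℓ ≥ 1` unit blocks per side,
`L ≥ 1`): `e₀ + A·C·(1 + log(ℓ·L^k)) ≤ (e₀ + A·C·(1 + log ℓ)) · (1 + k·log L)` — the `(1 + k log L)` of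
`LRRSized` clause 1 with `C_E := e₀ + A·C·(1 + log ℓ)`. [folklore] -/
theorem rowConst_le {e₀ A C ℓ L : ℝ} (he : 0 ≤ e₀) (hA : 0 ≤ A) (hC : 0 ≤ C) (hℓ : 1 ≤ ℓ) (hL : 1 ≤ L)
    (k : ℕ) :
    e₀ + A * C * (1 + Real.log (ℓ * L ^ k)) ≤ (e₀ + A * C * (1 + Real.log ℓ)) * (1 + k * Real.log L) := by
  have hℓ0 : 0 < ℓ := by linarith
  have hL0 : 0 < L := by linarith
  have hlog : Real.log (ℓ * L ^ k) = Real.log ℓ + k * Real.log L := by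
    rw [Real.log_mul hℓ0.ne' (pow_pos hL0 k).ne', Real.log_pow]
  rw [hlog]
  have h1 : 0 ≤ Real.log ℓ := Real.log_nonneg hℓ
  have h2 : 0 ≤ Real.log L := Real.log_nonneg hL
  have h3 : 0 ≤ (k : ℝ) * Real.log L := by positivity
  have hAC : 0 ≤ A * C := mul_nonneg hA hC
  nlinarith [mul_nonneg he h3, mul_nonneg (mul_nonneg hAC h1) h3]

/-- **The shell summation on a 1D window `[-N, N] ⊂ ℤ`** (the fibring of `shell_sum_le` with a genuine radius
`ρ = |·|`, `d = 1`, shells of ≤ 2 sites): `|f 0| ≤ e₀` and `|f y| ≤ C/|y|` (`y ≠ 0`) give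
`Σ_{|y| ≤ N} |f y| ≤ e₀ + 2C(1 + log N)`.  (In `d = 1` the two-spacing kernel itself has NO tail — §5 — this instance
only exercises the bookkeeping; the `|y|^{−d}` tail is a `d ≥ 2` phenomenon, module docstring (iii).) [folklore] -/
theorem shell_sum_dim1 (N : ℕ) (f : ℤ → ℝ) {e₀ C : ℝ} (hC : 0 ≤ C) (h0 : |f 0| ≤ e₀)
    (hf : ∀ y ∈ Icc (-(N : ℤ)) N, y ≠ 0 → |f y| ≤ C / (y.natAbs : ℝ)) :
    ∑ y ∈ Icc (-(N : ℤ)) N, |f y| ≤ e₀ + 2 * C * (1 + Real.log N) := by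
  have key := shell_sum_le (Icc (-(N : ℤ)) N) (fun y : ℤ => y.natAbs) f (N := N) (d := 1) le_rfl
    (A := 2) (e₀ := e₀) (C := C) (by norm_num) hC ?_ ?_ ?_ ?_
  · simpa using key
  · intro y hy
    obtain ⟨h1, h2⟩ := mem_Icc.mp hy
    omega
  · intro r _
    have hsub : (Icc (-(N : ℤ)) N).filter (fun y : ℤ => y.natAbs = r) ⊆ {(r : ℤ), -(r : ℤ)} := by
      intro y hy
      obtain ⟨-, hyr⟩ := mem_filter.mp hy
      rcases Int.natAbs_eq y with h | h <;> (rw [hyr] at h; rw [h]; simp)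
    calc (((Icc (-(N : ℤ)) N).filter (fun y : ℤ => y.natAbs = r)).card : ℝ)
        ≤ (({(r : ℤ), -(r : ℤ)} : Finset ℤ).card : ℝ) := by exact_mod_cast card_le_card hsub
      _ ≤ 2 := by exact_mod_cast Finset.card_le_two
      _ = 2 * (r : ℝ) ^ (1 - 1) := by simp
  · have hset : (Icc (-(N : ℤ)) N).filter (fun y : ℤ => y.natAbs = 0) = {0} := by
      ext y
      simp only [mem_filter, mem_Icc, Int.natAbs_eq_zero, mem_singleton]
      constructor
      · rintro ⟨-, rfl⟩; rfl
      · rintro rfl; exact ⟨⟨by omega, by omega⟩, rfl⟩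
    rw [hset, sum_singleton]
    exact h0
  · intro y hy hy1
    have hy0 : y ≠ 0 := by
      intro h; subst h; simp at hy1
    simpa using hf y hy hy0

end Shell

/-! ## §4 The re-keyed wall `TwoSpacingSized` and the node's shape BY NAME -/

section Wall

/-- **THE WALL OF NODE NE3 IN THE (115) CURRENCY, RE-KEYED (generation 4).**  Sized form of the two-spacing route
to clause 1 of `LRRSized`: with `rowE k V` = the `ℓ∞ → ℓ∞` norm (max row sum) of the two-spacing difference `E_W`,
`W = U_k(V)`, and `lam k V` = the sup of the one-step multiplier `λ̂` in level-k lattice units: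
(1) `z ≤ rowE · lam` (`abs_sum_mul_le`; `z = sup|Ẑ|`, `Z = E λ` by §1);
(2) `rowE ≤ C_E·(1 + k log L)` — THE UNPRINTED CLAUSE: the pointwise two-spacing kernel bound summed by `shell_sum_le`
    / `rowConst_le` (NOT PRINTED for Bałaban's covariant objects; flat scalar: toy + Lawler Thm 1.5.4-type asymptotics);
(3) `0 ≤ lam ≤ B·η³`, `η = L^{−k}` — printed TYPE: the multiplier is blockwise the fine current
    (`hardMinimiser_current`), bounded by the current clause of B11 (2)/(8) at level k+1.
A predicate — never used as a fact. [folklore] -/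
def TwoSpacingSized {ι : Type*} (dom : Set ι) (z rowE lam : ℕ → ι → ℝ) (L CE B : ℝ) : Prop :=
  (∀ k : ℕ, ∀ V ∈ dom, z k V ≤ rowE k V * lam k V) ∧
  (∀ k : ℕ, ∀ V ∈ dom, rowE k V ≤ CE * (1 + k * Real.log L)) ∧
  (∀ k : ℕ, ∀ V ∈ dom, 0 ≤ lam k V ∧ lam k V ≤ B * (L⁻¹ ^ k) ^ 3)

/-- **`TwoSpacingSized` ⇒ clause 1 of `LRRSized`** with `C_Z = C_E`. [folklore] -/
theorem lrr_clause1_of_twoSpacing {ι : Type*} {dom : Set ι} {z rowE lam : ℕ → ι → ℝ} {L CE B : ℝ}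
    (h : TwoSpacingSized dom z rowE lam L CE B) (hL : 1 ≤ L) (hCE : 0 ≤ CE) :
    ∀ k : ℕ, ∀ V ∈ dom, z k V ≤ CE * B * (1 + k * Real.log L) * (L⁻¹ ^ k) ^ 3 := by
  intro k V hV
  obtain ⟨h1, h2, h3⟩ := h
  obtain ⟨hl0, hl⟩ := h3 k V hV
  have hlogk : 0 ≤ CE * (1 + k * Real.log L) := by
    have := Real.log_nonneg hL
    positivity
  calc z k V ≤ rowE k V * lam k V := h1 k V hV
    _ ≤ CE * (1 + k * Real.log L) * lam k V := mul_le_mul_of_nonneg_right (h2 k V hV) hl0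
    _ ≤ CE * (1 + k * Real.log L) * (B * (L⁻¹ ^ k) ^ 3) := mul_le_mul_of_nonneg_left hl hlogk
    _ = CE * B * (1 + k * Real.log L) * (L⁻¹ ^ k) ^ 3 := by ring

/-- **`TwoSpacingSized` + the two printed-TYPE clauses ⇒ `LRRSized`** (the gen-3 wall by name, `C_Z = C_E`). [folklore] -/
theorem lrrSized_of_twoSpacing {ι : Type*} {dom : Set ι} {z rowE lam t osc : ℕ → ι → ℝ}
    {L CE B CP CD B0 CR : ℝ} (h : TwoSpacingSized dom z rowE lam L CE B) (hL : 1 ≤ L) (hCE : 0 ≤ CE)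
    (ht : ∀ k : ℕ, ∀ V ∈ dom, t k V ≤ B0 * CR * L⁻¹ ^ k)
    (hosc : ∀ k : ℕ, ∀ V ∈ dom, osc k V ≤ (1 + CD) * (1 + CP) * z k V / (L⁻¹ ^ k) ^ 2 + t k V) :
    LRRSized dom z t osc L CP CD CE B B0 CR :=
  ⟨lrr_clause1_of_twoSpacing h hL hCE, ht, hosc⟩

/-- **The node's shape BY NAME from the re-keyed wall**, log-absorbed rate `θ′ = (1 + log L)/L`, `L ≥ 2`:
`TwoSpacingSized` + tail + (115) bookkeeping + reading / response / pairing + «act = Σ loc, card ≤ vol» ⇒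
`NE3Shape R (Λr·Γ·((1 + C_D)(1 + C_Π)C_E B + B₀C_R) + ρ₂) θ′` (`T4OneStepFactorisation.ne3Shape_of_lrrSized`). [folklore] -/
theorem ne3Shape_of_twoSpacing {ι X : Type*} [Fintype X] {R : Readings ι X}
    {z rowE lam t osc nrm pair : ℕ → ι → ℝ} {L CE B CP CD B0 CR Γ Λr ρ₂ : ℝ}
    (h : TwoSpacingSized R.dom z rowE lam L CE B) (hL : 2 ≤ L) (hCE : 0 ≤ CE) (hCP : 0 ≤ CP) (hCD : 0 ≤ CD)
    (hB : 0 ≤ B) (hB0 : 0 ≤ B0) (hCR : 0 ≤ CR) (hΓ : 0 ≤ Γ) (hΛr : 0 ≤ Λr) (hρ₂ : 0 ≤ ρ₂)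
    (ht : ∀ k : ℕ, ∀ V ∈ R.dom, t k V ≤ B0 * CR * L⁻¹ ^ k)
    (hosc : ∀ k : ℕ, ∀ V ∈ R.dom, osc k V ≤ (1 + CD) * (1 + CP) * z k V / (L⁻¹ ^ k) ^ 2 + t k V)
    (hact : ∀ k : ℕ, ∀ V ∈ R.dom, R.act k V = ∑ x, R.loc k V x) (hvol : (Fintype.card X : ℝ) ≤ R.vol)
    (hread : ∀ k : ℕ, ∀ V ∈ R.dom, ∀ x : X,
      |R.loc (k + 1) V x - R.loc k V x| ≤ Λr * nrm k V + pair k V)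
    (hresp : ∀ k : ℕ, ∀ V ∈ R.dom, nrm k V ≤ Γ * osc k V)
    (hpair : OneStepCorrectionRate R.dom pair ρ₂ ((1 + Real.log L) / L)) :
    NE3Shape R (Λr * Γ * ((1 + CD) * (1 + CP) * CE * B + B0 * CR) + ρ₂) ((1 + Real.log L) / L) :=
  ne3Shape_of_lrrSized (lrrSized_of_twoSpacing h (by linarith) hCE ht hosc) hL hCP hCD hCE hB hB0 hCR hΓ hΛr
    hρ₂ hact hvol hread hresp hpair

/-- The same at any rate `L^{−a}`, `0 < a < 1`, `L > 1` (`T4OneStepFactorisation.ne3Shape_of_lrrSized_rpow`). [folklore] -/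
theorem ne3Shape_of_twoSpacing_rpow {ι X : Type*} [Fintype X] {R : Readings ι X}
    {z rowE lam t osc nrm pair : ℕ → ι → ℝ} {L CE B CP CD B0 CR Γ Λr ρ₂ a : ℝ}
    (h : TwoSpacingSized R.dom z rowE lam L CE B) (hL : 1 < L) (ha0 : 0 < a) (ha : a < 1) (hCE : 0 ≤ CE)
    (hCP : 0 ≤ CP) (hCD : 0 ≤ CD) (hB : 0 ≤ B) (hB0 : 0 ≤ B0) (hCR : 0 ≤ CR) (hΓ : 0 ≤ Γ) (hΛr : 0 ≤ Λr)
    (hρ₂ : 0 ≤ ρ₂)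
    (ht : ∀ k : ℕ, ∀ V ∈ R.dom, t k V ≤ B0 * CR * L⁻¹ ^ k)
    (hosc : ∀ k : ℕ, ∀ V ∈ R.dom, osc k V ≤ (1 + CD) * (1 + CP) * z k V / (L⁻¹ ^ k) ^ 2 + t k V)
    (hact : ∀ k : ℕ, ∀ V ∈ R.dom, R.act k V = ∑ x, R.loc k V x) (hvol : (Fintype.card X : ℝ) ≤ R.vol)
    (hread : ∀ k : ℕ, ∀ V ∈ R.dom, ∀ x : X,
      |R.loc (k + 1) V x - R.loc k V x| ≤ Λr * nrm k V + pair k V)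
    (hresp : ∀ k : ℕ, ∀ V ∈ R.dom, nrm k V ≤ Γ * osc k V)
    (hpair : OneStepCorrectionRate R.dom pair ρ₂ (L ^ (-a))) :
    NE3Shape R (Λr * Γ * ((1 + CD) * (1 + CP) * CE * B * (Real.exp (-a) / (1 - a)) + B0 * CR) + ρ₂)
      (L ^ (-a)) :=
  ne3Shape_of_lrrSized_rpow (lrrSized_of_twoSpacing h hL.le hCE ht hosc) hL ha0 ha hCP hCD hCE hB hB0 hCR hΓ
    hΛr hρ₂ hact hvol hread hresp hpair

end Wall

/-! ## §5 The 1D instance: `E = κ_L(δ − 1/N)`, row sum `2κ_L(1 − 1/N) < 1/3`, no logarithm -/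

section OneD

/-- The mean-zero representative of the 1D two-spacing kernel (`T4OneStepFactorisation.blockAvg_green`: on mean-zero
functions `S = G_c − κ_L·1`, so `E = G_c − S = κ_L(δ − 1/N)` modulo constants) has row sum
`Σ_{t<N} |κ([t = 0] − 1/N)| = 2κ(1 − 1/N)` for `κ ≥ 0`, `N ≥ 1`. [folklore] -/
theorem oneD_rowsum (κ : ℝ) (hκ : 0 ≤ κ) (N : ℕ) (hN : 1 ≤ N) :
    ∑ t ∈ range N, |κ * ((if t = 0 then (1 : ℝ) else 0) - 1 / N)| = 2 * κ * (1 - 1 / N) := by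
  have hN0 : (0 : ℝ) < N := by exact_mod_cast hN
  have hN1 : (1 : ℝ) ≤ N := by exact_mod_cast hN
  have hinvle : 1 / (N : ℝ) ≤ 1 := by rw [div_le_one hN0]; exact hN1
  rw [Finset.range_eq_Ico, Finset.sum_eq_sum_Ico_succ_bot hN]
  simp only [if_true]
  have hrest : ∑ t ∈ Ico 1 N, |κ * ((if t = 0 then (1 : ℝ) else 0) - 1 / N)| = ((N : ℝ) - 1) * (κ / N) := by
    rw [Finset.sum_congr rfl (g := fun _ => κ / N)]
    · rw [sum_const, Nat.card_Ico, nsmul_eq_mul, Nat.cast_sub hN, Nat.cast_one]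
    · intro t ht
      have ht0 : t ≠ 0 := by have := (mem_Ico.mp ht).1; omega
      rw [if_neg ht0, zero_sub, mul_neg, abs_neg, abs_of_nonneg (by positivity)]
      ring
  rw [hrest, abs_of_nonneg (mul_nonneg hκ (by linarith))]
  field_simp
  ring

/-- Hence in 1D the two-spacing row constant is `2κ_L(1 − 1/N) ≤ 2κ_L < 1/3`: the `C_E` of `TwoSpacingSized` is an
absolute constant, no `(1 + k log L)` (`T4OneStepKernel1D.kappa_lt_one_sixth`, `T4OneStepFactorisation.kappa_nonneg`).
[folklore] -/
theorem oneD_rowsum_lt {L : ℕ} (hL : 0 < L) (N : ℕ) (hN : 1 ≤ N) :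
    ∑ t ∈ range N, |kappa L * ((if t = 0 then (1 : ℝ) else 0) - 1 / N)| < 1 / 3 := by
  have hκ : 0 ≤ kappa L := kappa_nonneg hL
  have hκ6 := kappa_lt_one_sixth hL
  have hN0 : (0 : ℝ) < N := by exact_mod_cast hN
  rw [oneD_rowsum (kappa L) hκ N hN]
  have : 0 < 1 / (N : ℝ) := by positivity
  nlinarith

end OneD

/-! ## §6 Examples -/

section Examples

/-- The two-spacing identity in a commutative model with symbols: `G = K⁻¹`, `S = Λ⁻¹` on the complement of the zero
mode is the units form. -/
example (G S : ℝˣ) : (↑S⁻¹ : ℝ) - ↑G⁻¹ = ↑G⁻¹ * ((G : ℝ) - S) * ↑S⁻¹ := inv_sub_inv_eq_twoSpacing G S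

/-- Row-constant bookkeeping at `ℓ = 1` (one unit block per side), `e₀ = A = C = 1`, `L = 2`, `k = 3`. -/
example : (1 : ℝ) + 1 * 1 * (1 + Real.log (1 * 2 ^ 3)) ≤ (1 + 1 * 1 * (1 + Real.log 1)) * (1 + (3 : ℕ) * Real.log 2) :=
  rowConst_le zero_le_one zero_le_one zero_le_one le_rfl (by norm_num) 3

/-- The 1D row sum at `κ = 1/8` (`L = 2`), `N = 4`: `2·(1/8)·(3/4) = 3/16`. -/
example : ∑ t ∈ range 4, |(1 / 8 : ℝ) * ((if t = 0 then (1 : ℝ) else 0) - 1 / (4 : ℕ))| = 2 * (1 / 8) * (1 - 1 / (4 : ℕ)) :=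
  oneD_rowsum (1 / 8) (by norm_num) 4 (by norm_num)

end Examples

/-! ## §7 Generation 5 — CONSISTENCY × STABILITY: the two-grid truncation error of the fine minimiser -/

section Consistency

variable {R : Type*} [Ring R]

/-- **The two-grid commutator identity.**  With the LOCAL CONSISTENCY DEFECT `K := Q₁Δ_f − Δ_cQ₁` (fine Laplacian in
coarse units) and Green operators `G_cΔ_c = 1 − P_c`, `Δ_fG_f = 1 − P_f` (zero-mode projections `P`):
`Q₁G_f = G_cQ₁ − G_cKG_f − G_cQ₁P_f + P_cQ₁G_f`.  [model] Averaging the fine potential = the coarse potential of the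
averaged source, up to the PROPAGATED TRUNCATION ERROR `G_cKG_f` (Lax–Keller: consistency, then stability). [folklore] -/
theorem avg_green_comm {K Q1 Df Dc Gc Gf Pc Pf : R} (hK : K = Q1 * Df - Dc * Q1) (hGc : Gc * Dc = 1 - Pc)
    (hGf : Df * Gf = 1 - Pf) :
    Q1 * Gf = Gc * Q1 - Gc * K * Gf - Gc * Q1 * Pf + Pc * Q1 * Gf := by
  have h1 : Gc * K * Gf = Gc * Q1 * (Df * Gf) - Gc * Dc * (Q1 * Gf) := by rw [hK]; noncomm_ring
  rw [hGf, hGc] at h1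
  rw [h1]; noncomm_ring

/-- **Invertible version** — B9's `G⁻¹ = Δ_π + DRD* + Q*aQ` (3.122) is honestly invertible, no zero modes:
`Q₁G_f = G_cQ₁ − G_cKG_f`. [folklore] -/
theorem avg_green_comm_inv {K Q1 Df Dc Gc Gf : R} (hK : K = Q1 * Df - Dc * Q1) (hGc : Gc * Dc = 1)
    (hGf : Df * Gf = 1) : Q1 * Gf = Gc * Q1 - Gc * K * Gf := by
  have h := avg_green_comm (Pc := 0) (Pf := 0) hK (by rw [hGc, sub_zero]) (by rw [hGf, sub_zero])
  simpa using h

/-- **The two-spacing difference IS the propagated consistency defect** plus the averaging-normalisation term: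
`E := G_c − Q₁G_fQ₁* = G_cKG_fQ₁* + G_c(1 − Q₁Q₁*)`.  [model] `Q₁Q₁* = 1` for block means (then `E = G_cKG_fQ₁*`
exactly); for the slab means of B5 (1.11) `1 − Q₁Q₁*` is a second difference along the averaged direction. [folklore] -/
theorem twoSpacing_eq_consistency {K Q1 Q1ad Df Dc Gc Gf : R} (hK : K = Q1 * Df - Dc * Q1) (hGc : Gc * Dc = 1)
    (hGf : Df * Gf = 1) :
    Gc - Q1 * Gf * Q1ad = Gc * K * Gf * Q1ad + Gc * (1 - Q1 * Q1ad) := by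
  rw [avg_green_comm_inv hK hGc hGf]; noncomm_ring

/-- **The two-level response as propagated truncation error.**  Tower `Q_{k+1}* = Q₁*Q_k*`, fine minimiser
`U = G_f(Q_{k+1}*ω̃)` (B9 (3.123) at level k+1; `hardMinimiser_current`), `Π_k` fixing `Range(G_cQ_k*)`
(`(1 − Π_k)·G_cQ_k* = 0`: a field whose current is blockwise an averaging adjoint is its own hard minimiser).  Then
`−(1 − Π_k)·Q₁U = (1 − Π_k)·(G_c(KU) − G_c((Q₁Q₁* − 1)(Q_k*ω̃)))`, i.e. with `twoLevel_response_eq`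
`X = U_k − Q₁U_{k+1} = (1 − Π_k)·G_c·[τ − (C₁ − 1)λ]`, `τ := K·U_{k+1}` (the two-grid TRUNCATION ERROR of the fine
minimiser), `C₁ := Q₁Q₁*`, `λ := Q_k*ω̃`.  [toy] verified to 1e-9 (d = 1, 2, 3; block and slab means). [folklore] -/
theorem twoLevel_response_eq_consistency {K Q1 Q1ad Qkad Qk1ad Df Dc Gc Gf Pi ω : R}
    (hK : K = Q1 * Df - Dc * Q1) (hGc : Gc * Dc = 1) (hGf : Df * Gf = 1) (htower : Qk1ad = Q1ad * Qkad)
    (hfix : (1 - Pi) * (Gc * Qkad) = 0) :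
    -((1 - Pi) * (Q1 * (Gf * (Qk1ad * ω)))) =
      (1 - Pi) * (Gc * (K * (Gf * (Qk1ad * ω))) - Gc * ((Q1 * Q1ad - 1) * (Qkad * ω))) := by
  have hc := avg_green_comm_inv hK hGc hGf
  have h0 : (1 - Pi) * (Gc * Qkad) * ω = 0 := by rw [hfix, zero_mul]
  calc -((1 - Pi) * (Q1 * (Gf * (Qk1ad * ω))))
      = -((1 - Pi) * ((Q1 * Gf) * (Qk1ad * ω))) := by noncomm_ring
    _ = -((1 - Pi) * ((Gc * Q1 - Gc * K * Gf) * (Qk1ad * ω))) := by rw [hc]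
    _ = (1 - Pi) * (Gc * (K * (Gf * (Qk1ad * ω))) - Gc * ((Q1 * Q1ad - 1) * (Qkad * ω)))
          - (1 - Pi) * (Gc * Qkad) * ω := by rw [htower]; noncomm_ring
    _ = (1 - Pi) * (Gc * (K * (Gf * (Qk1ad * ω))) - Gc * ((Q1 * Q1ad - 1) * (Qkad * ω))) := by
          rw [h0, sub_zero]

/-- **Global neutrality of the truncation error.**  If a summation functional `σ_c` is co-harmonic (`σ_cΔ_c = 0`),
averaging preserves sums (`σ_cQ₁ = σ_f`) and `σ_fΔ_f = 0`, then `σ_cK = 0`: the two-grid truncation error has zero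
total charge.  [model] Locally `K` annihilates affine functions, so on each unit face `τ = KU_{k+1}` is a DIPOLE layer
([toy] net face charge → 0, dipole density → κ_L × the jump of `λ`). [folklore] -/
theorem truncation_neutral {K Q1 Df Dc σc σf : R} (hK : K = Q1 * Df - Dc * Q1) (hc : σc * Dc = 0)
    (havg : σc * Q1 = σf) (hf : σf * Df = 0) : σc * K = 0 := by
  rw [hK, mul_sub, ← mul_assoc, havg, hf, ← mul_assoc, hc, zero_mul, sub_zero]

/-- **Mass independence of the hard minimiser (push-through).**  If `G` right-inverts `Δ` and `G_a` left-inverts the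
averaging-massive operator `Δ + Q*·A·Q` (B9 (3.122): «G⁻¹ = Δ_π + DRD* + Q*aQ»), then `G_aQ* = GQ*·(1 + AQGQ*)⁻¹`.
[model] Hence the massless ring identities above apply verbatim to B9's massive propagators: the minimisers coincide
(`hardMinimiser_indep_of_avgMass`) and only the multiplier is shifted, `ω_a = (1 + AQGQ*)ω = ω + A·B`. [folklore] -/
theorem green_avgMass_pushThrough {D G Ga Q Qad A : R} (u : Rˣ) (hG : D * G = 1)
    (hGa : Ga * (D + Qad * A * Q) = 1) (hu : (u : R) = 1 + A * Q * G * Qad) :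
    Ga * Qad = G * Qad * ↑u⁻¹ := by
  have h1 : Ga * Qad * ↑u = G * Qad := by
    calc Ga * Qad * ↑u = Ga * ((D * G) * Qad + Qad * A * Q * G * Qad) := by rw [hu, hG]; noncomm_ring
      _ = Ga * (D + Qad * A * Q) * (G * Qad) := by noncomm_ring
      _ = G * Qad := by rw [hGa, one_mul]
  calc Ga * Qad = Ga * Qad * ↑u * ↑u⁻¹ := by rw [Units.mul_inv_cancel_right]
    _ = G * Qad * ↑u⁻¹ := by rw [h1]

/-- **The hard minimisers with and without the averaging mass coincide**: with `v = QGQ*` a unit,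
`QG_aQ* = v·u⁻¹` and `G_aQ*(QG_aQ*)⁻¹ = GQ*u⁻¹·(u v⁻¹) = GQ*v⁻¹ = H` (B9 (3.126) «HB = GQ*(QGQ*)⁻¹B»). [folklore] -/
theorem hardMinimiser_indep_of_avgMass {D G Ga Q Qad A : R} (u v : Rˣ) (hG : D * G = 1)
    (hGa : Ga * (D + Qad * A * Q) = 1) (hu : (u : R) = 1 + A * Q * G * Qad) (hv : (v : R) = Q * G * Qad) :
    Q * Ga * Qad = ↑(v * u⁻¹) ∧ Ga * Qad * ↑(v * u⁻¹)⁻¹ = G * Qad * ↑v⁻¹ := by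
  have hp := green_avgMass_pushThrough u hG hGa hu
  constructor
  · rw [Units.val_mul, hv, mul_assoc Q Ga Qad, hp]; noncomm_ring
  · rw [mul_inv_rev, inv_inv, Units.val_mul, ← mul_assoc, hp, Units.inv_mul_cancel_right]

end Consistency

section Layer

/-- **Layer summation (a double layer on the unit-face skeleton)** — `shell_sum_le` one dimension down: if the layer
sites at sup-distance `r ≥ 1` from `x` number `≤ A·r^{d−2}` (a codimension-1 layer) and the dipole kernel there is
`|f y| ≤ C·r^{−(d−1)}`, then `Σ_y |f y| ≤ e₀ + A·C·(1 + log N)` — the `(1 + k log L)` of clause (T2) of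
`ConsistencySized` via `rowConst_le`.  [model] Dictionary: `f y = ∇_yG_k(x,y)·𝟙_F(y)`, `F` = the unit faces within
lattice distance `N = ℓL^k`; the printed unit-scale exponential decay (B9 Thm 3.12) is part of `e₀`.  The pointwise
profile `|∇_yG_k(x,y)| ≤ C|x − y|^{1−d}` itself is the UNPRINTED input (W1). [folklore] -/
theorem layer_sum_le {ι : Type*} (s : Finset ι) (ρ : ι → ℕ) (f : ι → ℝ) {N d : ℕ} (hd : 2 ≤ d) {A e₀ C : ℝ}
    (hA : 0 ≤ A) (hC : 0 ≤ C) (hρN : ∀ y ∈ s, ρ y ≤ N)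
    (hcard : ∀ r : ℕ, 1 ≤ r → (((s.filter fun y => ρ y = r).card : ℝ)) ≤ A * (r : ℝ) ^ (d - 2))
    (h0 : ∑ y ∈ s.filter (fun y => ρ y = 0), |f y| ≤ e₀)
    (hf : ∀ y ∈ s, 1 ≤ ρ y → |f y| ≤ C / (ρ y : ℝ) ^ (d - 1)) :
    ∑ y ∈ s, |f y| ≤ e₀ + A * C * (1 + Real.log N) := by
  have hd1 : 1 ≤ d - 1 := by omega
  have hsub : d - 1 - 1 = d - 2 := by omega
  exact shell_sum_le s ρ f (N := N) (d := d - 1) hd1 hA hC hρN (by simpa only [hsub] using hcard) h0 hf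

end Layer

section WallRecut

/-- **THE WALL OF NODE NE3 IN THE (115) CURRENCY, RE-CUT (generation 5): CONSISTENCY × STABILITY.**  Per level `k`
and datum `V`: `z` = sup of the pre-current (as in `LRRSized`); `dl` = the DOUBLE-LAYER CONSTANT of the level-k
propagator, `sup_x Σ_{y ∈ faces} |∇_yG_k(x,y)|` (STABILITY); `sig` = sup of the face dipole density of the two-grid
truncation error `τ = KU_{k+1}(V)` (CONSISTENCY / transmission); `blk` = everything else of `G_c[τ − (C₁ − 1)λ]`
(bulk `∇⁴`-part, kink and edge strata, the normalisation term); `lam` = sup of the one-step multiplier `λ̂`: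
(T1) `z ≤ dl·sig + blk` (`twoLevel_response_eq_consistency` + `abs_sum_mul_le`);
(T2) `dl ≤ C_DL·(1 + k log L)` — UNPRINTED (W1): a POINTWISE sub-unit profile `|∇_yG_k(x,y)| ≤ C|x − y|^{1−d}`,
     `1 ≤ |x − y| ≤ L^k`, of B9's propagators (B9 prints unit-cube-localised operator bounds (3.42)–(3.47) and bounded
     kernels (3.49), (3.133) only), summed by `layer_sum_le` / `rowConst_le`;
(T3) `0 ≤ sig ≤ C_J·lam` — UNPRINTED (W2): the transmission structure of `U_{k+1}(V)` across unit faces (B11 (9)–(10)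
     print global `C^{1,β}` + bounded covariant Laplacian only); [toy] flat scalar: `C_J → κ_L = (L² − 1)/(6L²)`;
(T4) `0 ≤ blk ≤ C_B·(1 + k log L)·lam` — UNPRINTED, the same two inputs on the lower-dimensional strata;
(T5) `0 ≤ lam ≤ B·η³`, `η = L^{−k}` — printed TYPE (the multiplier is blockwise the fine current, B11 (2)/(8)).
A predicate — never used as a fact. [folklore] -/
def ConsistencySized {ι : Type*} (dom : Set ι) (z dl sig blk lam : ℕ → ι → ℝ) (L CDL CJ CB B : ℝ) : Prop :=
  (∀ k : ℕ, ∀ V ∈ dom, z k V ≤ dl k V * sig k V + blk k V) ∧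
  (∀ k : ℕ, ∀ V ∈ dom, dl k V ≤ CDL * (1 + k * Real.log L)) ∧
  (∀ k : ℕ, ∀ V ∈ dom, 0 ≤ sig k V ∧ sig k V ≤ CJ * lam k V) ∧
  (∀ k : ℕ, ∀ V ∈ dom, 0 ≤ blk k V ∧ blk k V ≤ CB * (1 + k * Real.log L) * lam k V) ∧
  (∀ k : ℕ, ∀ V ∈ dom, 0 ≤ lam k V ∧ lam k V ≤ B * (L⁻¹ ^ k) ^ 3)

/-- **`ConsistencySized` ⇒ clause 1 of `LRRSized`** with `C_Z = C_DL·C_J + C_B`. [folklore] -/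
theorem lrr_clause1_of_consistency {ι : Type*} {dom : Set ι} {z dl sig blk lam : ℕ → ι → ℝ}
    {L CDL CJ CB B : ℝ} (h : ConsistencySized dom z dl sig blk lam L CDL CJ CB B) (hL : 1 ≤ L)
    (hCDL : 0 ≤ CDL) (hCJ : 0 ≤ CJ) (hCB : 0 ≤ CB) :
    ∀ k : ℕ, ∀ V ∈ dom, z k V ≤ (CDL * CJ + CB) * B * (1 + k * Real.log L) * (L⁻¹ ^ k) ^ 3 := by
  intro k V hV
  obtain ⟨h1, h2, h3, h4, h5⟩ := h
  obtain ⟨hs0, hs⟩ := h3 k V hV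
  obtain ⟨_, hb⟩ := h4 k V hV
  obtain ⟨hl0, hl⟩ := h5 k V hV
  have hlog : 0 ≤ 1 + (k : ℝ) * Real.log L := by
    have := Real.log_nonneg hL
    positivity
  have hdl : dl k V * sig k V ≤ CDL * (1 + k * Real.log L) * (CJ * lam k V) :=
    calc dl k V * sig k V ≤ CDL * (1 + k * Real.log L) * sig k V :=
          mul_le_mul_of_nonneg_right (h2 k V hV) hs0
      _ ≤ CDL * (1 + k * Real.log L) * (CJ * lam k V) := mul_le_mul_of_nonneg_left hs (mul_nonneg hCDL hlog)
  have hsum : z k V ≤ (CDL * CJ + CB) * (1 + k * Real.log L) * lam k V := by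
    have hz := h1 k V hV
    nlinarith [hz, hdl, hb]
  have hcoef : 0 ≤ (CDL * CJ + CB) * (1 + k * Real.log L) := mul_nonneg (by positivity) hlog
  calc z k V ≤ (CDL * CJ + CB) * (1 + k * Real.log L) * lam k V := hsum
    _ ≤ (CDL * CJ + CB) * (1 + k * Real.log L) * (B * (L⁻¹ ^ k) ^ 3) := mul_le_mul_of_nonneg_left hl hcoef
    _ = (CDL * CJ + CB) * B * (1 + k * Real.log L) * (L⁻¹ ^ k) ^ 3 := by ring

/-- **`ConsistencySized` + the two printed-TYPE clauses ⇒ `LRRSized`** (the gen-3 wall by name,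
`C_Z = C_DL·C_J + C_B`). [folklore] -/
theorem lrrSized_of_consistency {ι : Type*} {dom : Set ι} {z dl sig blk lam t osc : ℕ → ι → ℝ}
    {L CDL CJ CB B CP CD B0 CR : ℝ} (h : ConsistencySized dom z dl sig blk lam L CDL CJ CB B) (hL : 1 ≤ L)
    (hCDL : 0 ≤ CDL) (hCJ : 0 ≤ CJ) (hCB : 0 ≤ CB)
    (ht : ∀ k : ℕ, ∀ V ∈ dom, t k V ≤ B0 * CR * L⁻¹ ^ k)
    (hosc : ∀ k : ℕ, ∀ V ∈ dom, osc k V ≤ (1 + CD) * (1 + CP) * z k V / (L⁻¹ ^ k) ^ 2 + t k V) :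
    LRRSized dom z t osc L CP CD (CDL * CJ + CB) B B0 CR :=
  ⟨lrr_clause1_of_consistency h hL hCDL hCJ hCB, ht, hosc⟩

/-- **The node's shape BY NAME from the re-cut wall**, log-absorbed rate `θ′ = (1 + log L)/L`, `L ≥ 2`
(`T4OneStepFactorisation.ne3Shape_of_lrrSized` with `C_Z = C_DL·C_J + C_B`). [folklore] -/
theorem ne3Shape_of_consistency {ι X : Type*} [Fintype X] {R : Readings ι X}
    {z dl sig blk lam t osc nrm pair : ℕ → ι → ℝ} {L CDL CJ CB B CP CD B0 CR Γ Λr ρ₂ : ℝ}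
    (h : ConsistencySized R.dom z dl sig blk lam L CDL CJ CB B) (hL : 2 ≤ L) (hCDL : 0 ≤ CDL) (hCJ : 0 ≤ CJ)
    (hCB : 0 ≤ CB) (hCP : 0 ≤ CP) (hCD : 0 ≤ CD) (hB : 0 ≤ B) (hB0 : 0 ≤ B0) (hCR : 0 ≤ CR) (hΓ : 0 ≤ Γ)
    (hΛr : 0 ≤ Λr) (hρ₂ : 0 ≤ ρ₂)
    (ht : ∀ k : ℕ, ∀ V ∈ R.dom, t k V ≤ B0 * CR * L⁻¹ ^ k)
    (hosc : ∀ k : ℕ, ∀ V ∈ R.dom, osc k V ≤ (1 + CD) * (1 + CP) * z k V / (L⁻¹ ^ k) ^ 2 + t k V)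
    (hact : ∀ k : ℕ, ∀ V ∈ R.dom, R.act k V = ∑ x, R.loc k V x) (hvol : (Fintype.card X : ℝ) ≤ R.vol)
    (hread : ∀ k : ℕ, ∀ V ∈ R.dom, ∀ x : X,
      |R.loc (k + 1) V x - R.loc k V x| ≤ Λr * nrm k V + pair k V)
    (hresp : ∀ k : ℕ, ∀ V ∈ R.dom, nrm k V ≤ Γ * osc k V)
    (hpair : OneStepCorrectionRate R.dom pair ρ₂ ((1 + Real.log L) / L)) :
    NE3Shape R (Λr * Γ * ((1 + CD) * (1 + CP) * (CDL * CJ + CB) * B + B0 * CR) + ρ₂) ((1 + Real.log L) / L) :=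
  ne3Shape_of_lrrSized (lrrSized_of_consistency h (by linarith) hCDL hCJ hCB ht hosc) hL hCP hCD (by positivity)
    hB hB0 hCR hΓ hΛr hρ₂ hact hvol hread hresp hpair

/-- The same at any rate `L^{−a}`, `0 < a < 1`, `L > 1` (`T4OneStepFactorisation.ne3Shape_of_lrrSized_rpow`). [folklore] -/
theorem ne3Shape_of_consistency_rpow {ι X : Type*} [Fintype X] {R : Readings ι X}
    {z dl sig blk lam t osc nrm pair : ℕ → ι → ℝ} {L CDL CJ CB B CP CD B0 CR Γ Λr ρ₂ a : ℝ}
    (h : ConsistencySized R.dom z dl sig blk lam L CDL CJ CB B) (hL : 1 < L) (ha0 : 0 < a) (ha : a < 1)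
    (hCDL : 0 ≤ CDL) (hCJ : 0 ≤ CJ) (hCB : 0 ≤ CB) (hCP : 0 ≤ CP) (hCD : 0 ≤ CD) (hB : 0 ≤ B) (hB0 : 0 ≤ B0)
    (hCR : 0 ≤ CR) (hΓ : 0 ≤ Γ) (hΛr : 0 ≤ Λr) (hρ₂ : 0 ≤ ρ₂)
    (ht : ∀ k : ℕ, ∀ V ∈ R.dom, t k V ≤ B0 * CR * L⁻¹ ^ k)
    (hosc : ∀ k : ℕ, ∀ V ∈ R.dom, osc k V ≤ (1 + CD) * (1 + CP) * z k V / (L⁻¹ ^ k) ^ 2 + t k V)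
    (hact : ∀ k : ℕ, ∀ V ∈ R.dom, R.act k V = ∑ x, R.loc k V x) (hvol : (Fintype.card X : ℝ) ≤ R.vol)
    (hread : ∀ k : ℕ, ∀ V ∈ R.dom, ∀ x : X,
      |R.loc (k + 1) V x - R.loc k V x| ≤ Λr * nrm k V + pair k V)
    (hresp : ∀ k : ℕ, ∀ V ∈ R.dom, nrm k V ≤ Γ * osc k V)
    (hpair : OneStepCorrectionRate R.dom pair ρ₂ (L ^ (-a))) :
    NE3Shape R (Λr * Γ * ((1 + CD) * (1 + CP) * (CDL * CJ + CB) * B * (Real.exp (-a) / (1 - a)) + B0 * CR) + ρ₂)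
      (L ^ (-a)) :=
  ne3Shape_of_lrrSized_rpow (lrrSized_of_consistency h hL.le hCDL hCJ hCB ht hosc) hL ha0 ha hCP hCD
    (by positivity) hB hB0 hCR hΓ hΛr hρ₂ hact hvol hread hresp hpair

end WallRecut

section ExamplesGen5

/-- Push-through in a commutative model: `Δ = 2`, `G = 1/2`, `Q = Q* = 1`, averaging mass `A = 2`, so
`G_a = (2 + 2)⁻¹ = 1/4`, `u = 1 + 2·(1/2) = 2` and `G_aQ* = GQ*u⁻¹ = (1/2)·(1/2)`. -/
example : (1 / 4 : ℝ) * 1 = 1 / 2 * 1 * ↑(Units.mk0 (2 : ℝ) two_ne_zero)⁻¹ :=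
  green_avgMass_pushThrough (D := 2) (A := 2) (Q := 1) (Units.mk0 (2 : ℝ) two_ne_zero) (by norm_num) (by norm_num)
    (by norm_num)

/-- Layer bookkeeping at `d = 2` (faces are lines, shells of ≤ `A` sites, kernel `C/r`): the `shell_sum_dim1` shape. -/
example (s : Finset ℤ) (N : ℕ) (f : ℤ → ℝ) (hN : ∀ y ∈ s, y.natAbs ≤ N)
    (hcard : ∀ r : ℕ, 1 ≤ r → (((s.filter fun y => y.natAbs = r).card : ℝ)) ≤ 2 * (r : ℝ) ^ (2 - 2))
    (h0 : ∑ y ∈ s.filter (fun y => y.natAbs = 0), |f y| ≤ 1)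
    (hf : ∀ y ∈ s, 1 ≤ y.natAbs → |f y| ≤ 3 / (y.natAbs : ℝ) ^ (2 - 1)) :
    ∑ y ∈ s, |f y| ≤ 1 + 2 * 3 * (1 + Real.log N) :=
  layer_sum_le s (fun y => y.natAbs) f (d := 2) le_rfl (by norm_num) (by norm_num) hN hcard h0 hf

end ExamplesGen5

end Literature.MathematicalPhysics.QuantumFieldTheory.Balaban1983to89.T4TwoSpacingDefect
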